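import Mathlib.Analysis.InnerProductSpace.Calculus
import Mathlib.Analysis.SpecialFunctions.Pow.Deriv
import Literature.MathematicalPhysics.KineticTheory.HardSphereEulerProofs

/-!
# Amplitude transfer — the one-body score of a path of local Gibbs profiles

Calculus of the one-particle local Gibbs profile `f(x,v) = a(x) M_{1,u(x),θ(x)}(v)` along a path
of profiles `s ↦ (a_s, u_s, θ_s)` (route `VitaliAmplitudeTransfer`, item `AmplitudeTransfer`,
step (4) of the transfer: the `δ`-derivative of local Gibbs means):

* `localGibbsProfile_eq_exp` — `f = exp ℓ` with `ℓ = log a - (3/2) log (2πθ) - |v - u|²/(2θ)`;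
* `hasDerivAt_logProfile` — the score `∂_s ℓ = a'/a - (3/2) θ'/θ + ⟪v - u, u'⟫/θ + |v - u|² θ'/(2θ²)`;
* `abs_score_le` — the quadratic velocity growth `|score| ≤ 10 K₁ B⁴ (1 + |v|²)` under two-sided
  profile bounds `B` and derivative bounds `K₁`;
* `continuous_score` — continuity in `(x, v)`;
* `localGibbsProfile_le_envelope` — the Gaussian envelope `f(x,v) ≤ C_B exp (-|v|²/(4B))`,
  uniform along the path.

The log-profile, the score and the envelope constant are written out explicitly, so that no new
definition is introduced.
-/

noncomputable section

open MeasureTheory Real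
open scoped InnerProductSpace

namespace Summit.AtomisticToContinuum.HydrodynamicLimit.Theorems.AmplitudeTransfer

open Literature.MathematicalPhysics.KineticTheory Literature.Analysis.FluidPDE

/-- The local Gibbs profile is the exponential of the log-profile (positive activity and
temperature). -/
theorem localGibbsProfile_eq_exp {a₀ θ₀ : T3 → ℝ} {u₀ : T3 → V3} {x : T3} (v : V3)
    (ha : 0 < a₀ x) (hθ : 0 < θ₀ x) :
    localGibbsProfile a₀ u₀ θ₀ (x, v) = Real.exp ((Real.log (a₀ x) - 3 / 2 * Real.log (2 * π * (θ₀ x)) - ‖v - (u₀ x)‖ ^ 2 / (2 * (θ₀ x)))) := by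
  have h2 : 0 < 2 * π * θ₀ x := by positivity
  have hlog : (Real.log (a₀ x) - 3 / 2 * Real.log (2 * π * (θ₀ x)) - ‖v - (u₀ x)‖ ^ 2 / (2 * (θ₀ x))) = Real.log (a₀ x) +
      Real.log (2 * π * θ₀ x) * (-(3 : ℝ) / 2) + -‖v - u₀ x‖ ^ 2 / (2 * θ₀ x) := by
    ring
  rw [hlog, Real.exp_add, Real.exp_add, Real.exp_log ha, ← Real.rpow_def_of_pos h2]
  unfold localGibbsProfile localMaxwellian
  simp only [finrank_euclideanSpace_fin, Nat.cast_ofNat, one_mul]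
  ring

/-- The local Gibbs profile is positive (positive activity and temperature). -/
theorem localGibbsProfile_pos' {a₀ θ₀ : T3 → ℝ} {u₀ : T3 → V3} {x : T3} (v : V3)
    (ha : 0 < a₀ x) (hθ : 0 < θ₀ x) : 0 < localGibbsProfile a₀ u₀ θ₀ (x, v) := by
  rw [localGibbsProfile_eq_exp v ha hθ]
  exact Real.exp_pos _

/-- **The score is the derivative of the log-profile along the path.** -/
theorem hasDerivAt_logProfile {a θ : ℝ → ℝ} {u : ℝ → V3} {a' θ' : ℝ} {u' : V3} {s : ℝ} (v : V3)
    (ha : HasDerivAt a a' s) (hθ : HasDerivAt θ θ' s) (hu : HasDerivAt u u' s)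
    (ha0 : 0 < a s) (hθ0 : 0 < θ s) :
    HasDerivAt (fun r => (Real.log (a r) - 3 / 2 * Real.log (2 * π * (θ r)) - ‖v - (u r)‖ ^ 2 / (2 * (θ r)))) ((a' / (a s) - 3 / 2 * (θ' / (θ s)) + ⟪v - (u s), u'⟫_ℝ / (θ s) + ‖v - (u s)‖ ^ 2 * θ' / (2 * (θ s) ^ 2))) s := by
  have hπθ : 0 < 2 * π * θ s := by positivity
  have h1 : HasDerivAt (fun r => Real.log (a r)) (a' / a s) s := ha.log ha0.ne'
  have h2 : HasDerivAt (fun r => Real.log (2 * π * θ r)) ((2 * π * θ') / (2 * π * θ s)) s :=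
    (hθ.const_mul (2 * π)).log hπθ.ne'
  have h3 : HasDerivAt (fun r => ‖v - u r‖ ^ 2) (2 * ⟪v - u s, (0 : V3) - u'⟫_ℝ) s :=
    ((hasDerivAt_const s v).sub hu).norm_sq
  have h4 : HasDerivAt (fun r => 2 * θ r) (2 * θ') s := hθ.const_mul 2
  have h5 : HasDerivAt (fun r => ‖v - u r‖ ^ 2 / (2 * θ r))
      ((2 * ⟪v - u s, (0 : V3) - u'⟫_ℝ * (2 * θ s) - ‖v - u s‖ ^ 2 * (2 * θ')) / (2 * θ s) ^ 2) s :=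
    h3.div h4 (by positivity)
  have h := (h1.sub (h2.const_mul (3 / 2))).sub h5
  refine h.congr_deriv ?_
  rw [zero_sub, inner_neg_right]
  have hθne : θ s ≠ 0 := hθ0.ne'
  have hπ : (π : ℝ) ≠ 0 := Real.pi_ne_zero
  field_simp
  ring

/-- **Quadratic velocity growth of the score**: under two-sided profile bounds `B ≥ 1` and
derivative bounds `K₁`, `|score| ≤ 10 K₁ B⁴ (1 + |v|²)`. -/
theorem abs_score_le {B K₁ : ℝ} (hB : 1 ≤ B) (hK : 0 ≤ K₁) {a a' θ θ' : ℝ} {u u' v : V3}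
    (ha : B⁻¹ ≤ a) (hθ : B⁻¹ ≤ θ) (hu : ‖u‖ ≤ B) (ha' : |a'| ≤ K₁)
    (hθ' : |θ'| ≤ K₁) (hu' : ‖u'‖ ≤ K₁) :
    |(a' / a - 3 / 2 * (θ' / θ) + ⟪v - u, u'⟫_ℝ / θ + ‖v - u‖ ^ 2 * θ' / (2 * θ ^ 2))| ≤ 10 * K₁ * B ^ 4 * (1 + ‖v‖ ^ 2) := by
  have hB0 : 0 < B := by linarith
  have hBi : 0 < B⁻¹ := inv_pos.2 hB0
  have ha0 : 0 < a := lt_of_lt_of_le hBi ha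
  have hθ0 : 0 < θ := lt_of_lt_of_le hBi hθ
  set t : ℝ := ‖v‖ with ht
  have ht0 : 0 ≤ t := norm_nonneg _
  have hB2 : 1 ≤ B ^ 2 := by nlinarith
  have hB4 : B ≤ B ^ 4 := by nlinarith
  have hB24 : B ^ 2 ≤ B ^ 4 := by nlinarith
  have hKB4 : 0 ≤ K₁ * B ^ 4 := by positivity
  -- `1/a ≤ B`, `1/θ ≤ B`
  have hainv : a⁻¹ ≤ B := by
    rw [inv_le_comm₀ ha0 hB0]; exact ha
  have hθinv : θ⁻¹ ≤ B := by
    rw [inv_le_comm₀ hθ0 hB0]; exact hθ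
  -- term 1
  have T1 : |a' / a| ≤ K₁ * B ^ 4 * (1 + t ^ 2) := by
    rw [abs_div, abs_of_pos ha0, div_eq_mul_inv]
    calc |a'| * a⁻¹ ≤ K₁ * B := mul_le_mul ha' hainv (inv_nonneg.2 ha0.le) hK
      _ ≤ K₁ * B ^ 4 * 1 := by rw [mul_one]; exact mul_le_mul_of_nonneg_left hB4 hK
      _ ≤ K₁ * B ^ 4 * (1 + t ^ 2) := by gcongr; nlinarith
  -- term 2
  have T2 : |3 / 2 * (θ' / θ)| ≤ 3 / 2 * (K₁ * B ^ 4 * (1 + t ^ 2)) := by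
    rw [abs_mul, abs_of_pos (by norm_num : (0 : ℝ) < 3 / 2), abs_div, abs_of_pos hθ0,
      div_eq_mul_inv]
    gcongr
    calc |θ'| * θ⁻¹ ≤ K₁ * B := mul_le_mul hθ' hθinv (inv_nonneg.2 hθ0.le) hK
      _ ≤ K₁ * B ^ 4 * 1 := by rw [mul_one]; exact mul_le_mul_of_nonneg_left hB4 hK
      _ ≤ K₁ * B ^ 4 * (1 + t ^ 2) := by gcongr; nlinarith
  -- term 3
  have hvu : ‖v - u‖ ≤ t + B := (norm_sub_le v u).trans (by rw [ht]; linarith)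
  have T3 : |⟪v - u, u'⟫_ℝ / θ| ≤ 2 * (K₁ * B ^ 4 * (1 + t ^ 2)) := by
    rw [abs_div, abs_of_pos hθ0, div_eq_mul_inv]
    have hin : |⟪v - u, u'⟫_ℝ| ≤ (t + B) * K₁ :=
      (abs_real_inner_le_norm _ _).trans (mul_le_mul hvu hu' (norm_nonneg _) (by linarith))
    have ht1 : t ≤ 1 + t ^ 2 := by nlinarith [sq_nonneg (t - 1 / 2)]
    have hkey : (t + B) * B ≤ 2 * (B ^ 4 * (1 + t ^ 2)) := by
      have e1 : B * t ≤ B * (1 + t ^ 2) := mul_le_mul_of_nonneg_left ht1 hB0.le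
      have e2 : B * (1 + t ^ 2) ≤ B ^ 4 * (1 + t ^ 2) :=
        mul_le_mul_of_nonneg_right hB4 (by positivity)
      have e3 : B * B ≤ B ^ 4 * (1 + t ^ 2) := by
        calc B * B = B ^ 2 * 1 := by ring
          _ ≤ B ^ 4 * (1 + t ^ 2) := mul_le_mul hB24 (by nlinarith) zero_le_one (by positivity)
      nlinarith
    calc |⟪v - u, u'⟫_ℝ| * θ⁻¹ ≤ (t + B) * K₁ * B :=
          mul_le_mul hin hθinv (inv_nonneg.2 hθ0.le) (by positivity)
      _ = K₁ * ((t + B) * B) := by ring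
      _ ≤ K₁ * (2 * (B ^ 4 * (1 + t ^ 2))) := mul_le_mul_of_nonneg_left hkey hK
      _ = 2 * (K₁ * B ^ 4 * (1 + t ^ 2)) := by ring
  -- term 4
  have T4 : |‖v - u‖ ^ 2 * θ' / (2 * θ ^ 2)| ≤ K₁ * B ^ 4 * (1 + t ^ 2) := by
    rw [abs_div, abs_mul, abs_of_nonneg (sq_nonneg _), abs_of_pos (by positivity : 0 < 2 * θ ^ 2),
      div_eq_mul_inv]
    have hsq : ‖v - u‖ ^ 2 ≤ 2 * t ^ 2 + 2 * B ^ 2 := by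
      have h0 : 0 ≤ ‖v - u‖ := norm_nonneg _
      calc ‖v - u‖ ^ 2 ≤ (t + B) ^ 2 := pow_le_pow_left₀ h0 hvu 2
        _ ≤ 2 * t ^ 2 + 2 * B ^ 2 := by nlinarith [sq_nonneg (t - B)]
    have hθ2inv : (2 * θ ^ 2)⁻¹ ≤ B ^ 2 / 2 := by
      rw [inv_le_comm₀ (by positivity) (by positivity)]
      have : (B ^ 2 / 2)⁻¹ = 2 * (B⁻¹) ^ 2 := by field_simp
      rw [this]
      gcongr
    calc ‖v - u‖ ^ 2 * |θ'| * (2 * θ ^ 2)⁻¹ ≤ (2 * t ^ 2 + 2 * B ^ 2) * K₁ * (B ^ 2 / 2) := by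
          apply mul_le_mul (mul_le_mul hsq hθ' (abs_nonneg _) (by positivity)) hθ2inv
            (inv_nonneg.2 (by positivity)) (by positivity)
      _ = K₁ * B ^ 2 * t ^ 2 + K₁ * (B ^ 2 * B ^ 2) := by ring
      _ ≤ K₁ * B ^ 4 * t ^ 2 + K₁ * B ^ 4 := by
          gcongr
          nlinarith
      _ = K₁ * B ^ 4 * (1 + t ^ 2) := by ring
  -- sum
  calc |a' / a - 3 / 2 * (θ' / θ) + ⟪v - u, u'⟫_ℝ / θ + ‖v - u‖ ^ 2 * θ' / (2 * θ ^ 2)|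
      ≤ |a' / a| + |3 / 2 * (θ' / θ)| + |⟪v - u, u'⟫_ℝ / θ| + |‖v - u‖ ^ 2 * θ' / (2 * θ ^ 2)| := by
        have e1 := abs_sub (a' / a) (3 / 2 * (θ' / θ))
        have e2 := abs_add_le (a' / a - 3 / 2 * (θ' / θ)) (⟪v - u, u'⟫_ℝ / θ)
        have e3 := abs_add_le (a' / a - 3 / 2 * (θ' / θ) + ⟪v - u, u'⟫_ℝ / θ)
          (‖v - u‖ ^ 2 * θ' / (2 * θ ^ 2))
        linarith
    _ ≤ (1 + 3 / 2 + 2 + 1) * (K₁ * B ^ 4 * (1 + t ^ 2)) := by linarith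
    _ ≤ 10 * K₁ * B ^ 4 * (1 + ‖v‖ ^ 2) := by rw [← ht]; nlinarith

/-- The score is continuous in `(x, v)` when the profiles and their path-velocities are
continuous in `x` and activity and temperature do not vanish. -/
theorem continuous_score {a a' θ θ' : T3 → ℝ} {u u' : T3 → V3} (ha : Continuous a)
    (ha' : Continuous a') (hθ : Continuous θ) (hθ' : Continuous θ') (hu : Continuous u)
    (hu' : Continuous u') (ha0 : ∀ x, a x ≠ 0) (hθ0 : ∀ x, θ x ≠ 0) :
    Continuous fun y : T3 × V3 =>
      ((a' y.1) / (a y.1) - 3 / 2 * ((θ' y.1) / (θ y.1)) + ⟪y.2 - (u y.1), (u' y.1)⟫_ℝ / (θ y.1) + ‖y.2 - (u y.1)‖ ^ 2 * (θ' y.1) / (2 * (θ y.1) ^ 2)) := by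
  have hfst : Continuous fun y : T3 × V3 => y.1 := continuous_fst
  have hsnd : Continuous fun y : T3 × V3 => y.2 := continuous_snd
  have hvu : Continuous fun y : T3 × V3 => y.2 - u y.1 := hsnd.sub (hu.comp hfst)
  refine ((((ha'.comp hfst).div (ha.comp hfst) fun y => ha0 y.1).sub
    (continuous_const.mul ((hθ'.comp hfst).div (hθ.comp hfst) fun y => hθ0 y.1))).add
    ((hvu.inner (hu'.comp hfst)).div (hθ.comp hfst) fun y => hθ0 y.1)).add ?_
  exact ((hvu.norm.pow 2).mul (hθ'.comp hfst)).div (continuous_const.mul ((hθ.comp hfst).pow 2))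
    fun y => mul_ne_zero two_ne_zero (pow_ne_zero 2 (hθ0 y.1))

/-- The envelope constant is nonnegative (`B > 0`). -/
theorem envConst_nonneg {B : ℝ} (hB : 0 < B) : 0 ≤ (B * (2 * π * B⁻¹) ^ (-(3 : ℝ) / 2) * Real.exp (B / 2)) := by
  positivity

/-- **Gaussian envelope, uniform along the path**: within two-sided profile bounds `B ≥ 1`,
`f(x,v) ≤ C_B exp (-|v|²/(4B))`. -/
theorem localGibbsProfile_le_envelope {B : ℝ} (hB : 1 ≤ B) {a₀ θ₀ : T3 → ℝ} {u₀ : T3 → V3}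
    (x : T3) (v : V3) (ha : a₀ x ≤ B) (hθ : B⁻¹ ≤ θ₀ x) (hθB : θ₀ x ≤ B)
    (hu : ‖u₀ x‖ ≤ B) :
    localGibbsProfile a₀ u₀ θ₀ (x, v) ≤ (B * (2 * π * B⁻¹) ^ (-(3 : ℝ) / 2) * Real.exp (B / 2)) * Real.exp (-‖v‖ ^ 2 / (4 * B)) := by
  have hB0 : 0 < B := by linarith
  have hθ0 : 0 < θ₀ x := lt_of_lt_of_le (inv_pos.2 hB0) hθ
  unfold localGibbsProfile localMaxwellian
  simp only [finrank_euclideanSpace_fin, Nat.cast_ofNat, one_mul]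
  -- the power factor is antitone in `θ`
  have hpow : (2 * π * θ₀ x) ^ (-(3 : ℝ) / 2) ≤ (2 * π * B⁻¹) ^ (-(3 : ℝ) / 2) :=
    Real.rpow_le_rpow_of_nonpos (by positivity) (by gcongr) (by norm_num)
  -- the exponential factor
  have hexp : Real.exp (-‖v - u₀ x‖ ^ 2 / (2 * θ₀ x)) ≤
      Real.exp (B / 2) * Real.exp (-‖v‖ ^ 2 / (4 * B)) := by
    rw [← Real.exp_add]
    gcongr
    have h1 : -‖v - u₀ x‖ ^ 2 / (2 * θ₀ x) ≤ -‖v - u₀ x‖ ^ 2 / (2 * B) := by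
      rw [neg_div, neg_div, neg_le_neg_iff]
      exact div_le_div_of_nonneg_left (sq_nonneg _) (by positivity) (by linarith)
    have h2 : ‖v‖ ^ 2 ≤ 2 * ‖v - u₀ x‖ ^ 2 + 2 * B ^ 2 := by
      have htri : ‖v‖ ≤ ‖v - u₀ x‖ + B := by
        calc ‖v‖ = ‖(v - u₀ x) + u₀ x‖ := by rw [sub_add_cancel]
          _ ≤ ‖v - u₀ x‖ + ‖u₀ x‖ := norm_add_le _ _
          _ ≤ ‖v - u₀ x‖ + B := by linarith
      calc ‖v‖ ^ 2 ≤ (‖v - u₀ x‖ + B) ^ 2 := pow_le_pow_left₀ (norm_nonneg v) htri 2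
        _ ≤ 2 * ‖v - u₀ x‖ ^ 2 + 2 * B ^ 2 := by nlinarith [sq_nonneg (‖v - u₀ x‖ - B)]
    have h3 : -‖v - u₀ x‖ ^ 2 / (2 * B) ≤ B / 2 + -‖v‖ ^ 2 / (4 * B) := by
      rw [div_add_div _ _ (by norm_num : (2 : ℝ) ≠ 0) (by positivity : 4 * B ≠ 0),
        div_le_div_iff₀ (by positivity) (by positivity)]
      nlinarith
    linarith
  have hrest : (2 * π * θ₀ x) ^ (-(3 : ℝ) / 2) * Real.exp (-‖v - u₀ x‖ ^ 2 / (2 * θ₀ x)) ≤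
      (2 * π * B⁻¹) ^ (-(3 : ℝ) / 2) * (Real.exp (B / 2) * Real.exp (-‖v‖ ^ 2 / (4 * B))) :=
    mul_le_mul hpow hexp (Real.exp_pos _).le (by positivity)
  calc a₀ x * ((2 * π * θ₀ x) ^ (-(3 : ℝ) / 2) * Real.exp (-‖v - u₀ x‖ ^ 2 / (2 * θ₀ x)))
      ≤ B * ((2 * π * B⁻¹) ^ (-(3 : ℝ) / 2) * (Real.exp (B / 2) * Real.exp (-‖v‖ ^ 2 / (4 * B)))) :=
        mul_le_mul ha hrest (by positivity) hB0.le
    _ = B * (2 * π * B⁻¹) ^ (-(3 : ℝ) / 2) * Real.exp (B / 2) * Real.exp (-‖v‖ ^ 2 / (4 * B)) := by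
        ring

end Summit.AtomisticToContinuum.HydrodynamicLimit.Theorems.AmplitudeTransfer

end
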